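import Summits.ResolutionOfSingularities.ResolutionOfSingularities.Theses.FrobeniusClosing
import Literature.AlgebraicGeometry.Resolution.Blowups
import Literature.AlgebraicGeometry.Resolution.BlowupsFlatBaseChange
import Literature.AlgebraicGeometry.Resolution.BlowupsIntegral
import Literature.AlgebraicGeometry.Resolution.BlowupsComposition
import Literature.AlgebraicGeometry.Resolution.BlowupsProperProofs
import Literature.AlgebraicGeometry.Resolution.BlowupsFacts
import Literature.AlgebraicGeometry.Resolution.AdicCompletionRegular
import Literature.AlgebraicGeometry.Resolution.ProjectiveSpaceRegular

/-!
# Negative-lane lemmas for crux `PatchingRelPerfect` (stmt-ResolutionOfSingularities-16161), line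
# `closed-point-slice`, stub `stub_punctualCompletePerfectFour`: which hypotheses of the atom
# `PunctualCompletePerfect p n` are load-bearing, and what its single-blow-up format costs

The registered line `Cruxes/PatchingRelPerfect/Lines/closed_point_slice.lean` cuts the crux at
the atom `PunctualCompletePerfect p 4`: for a complete regular local `S` of equal characteristic
`p`, dimension `≤ 4`, PERFECT residue field, and `T` integral, proper and birational over `Spec S`,
regular off the closed fibre, there is a NON-ZERO ideal sheaf `J` on `T` cosupported in the closed
fibre and a blow-up `π : T' ⟶ T` along `J` with `T'` regular. Findings of the standing disprover
(cdisprove gen 2; `Cruxes/PatchingRelPerfect/Disproof.lean` §7), all PROVED, statements inlined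
(the atom lives in a crux work file and is restated verbatim where needed):

* `isRegularLocalRing_stalk_of_isBlowup_of_notMem_support`,
  `isRegularLocalRing_stalk_offFibre_of_isBlowup` — the CONCLUSION of the atom forces its
  hypothesis "`T` regular off the closed fibre" (a blow-up with regular source leaves the target
  regular off the centre). `offFibre_regular_of_atom_without_offFibre_hyp` — so the atom with that
  hypothesis dropped would make every integral proper birational `T` regular off the closed
  fibre, which fails from `n = 3` on (witness in the docstring): the hypothesis is LOAD-BEARING and
  cannot be weakened.
* `resolution_all_dims_of_atom_without_birational` — `IsBirational f` dropped: with `S := κ` the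
  perfect ground field itself (dimension `0`), the mutated atom desingularizes EVERY integral
  proper scheme over every perfect field of characteristic `p` in every dimension by one blow-up;
  birationality is what makes the dimension bound bite — LOAD-BEARING.
* `punctual_atom_dim_zero` — the base case `n = 0` of the atom HOLDS (all `p`): the typing is
  consistent, `J = ⊤` with the identity blow-up is a legitimate answer on a regular `T`, and the
  clause `J ≠ ⊥` only excludes the empty blow-up (`isBlowup_ne_bot_of_nonempty`: any blow-up with
  non-empty source is along a non-zero ideal, so `J ≠ ⊥` is implied by `T' ≠ ∅`).
* `exists_isBlowup_supported_of_tower`, `atomConclusion_of_two_step` — the single-blow-up FORMAT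
  is not a restriction: a tower of blow-ups with centres over the closed fibre is one blow-up along
  a non-zero ideal cosupported in the closed fibre (Raynaud / Stacks 080B, tree
  `IsBlowup.exists_isBlowup_comp_supported`); so the atom is equivalent to "desingularization of
  `T` by finitely many blow-ups with centres over the closed point", the format of every known
  resolution algorithm, and no refutation can come from the format alone.
* `isResolution_and_isIso_offFibre_of_atomConclusion` — conversely the atom's output IS a
  resolution of `T` which is an isomorphism off the closed fibre (properness and birationality of
  blow-ups, Stacks 02NS / 02ND, proved in tree): the atom implies the fibre-free weak form for the
  same `T` (the shape of `FibreFreePerfClosed`), and is implied by nothing weaker than a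
  fibre-supported blow-up tower — it sits strictly between weak and strong resolution of `T`.

Consequence for the line: the atom is irrefutable short of an integral fourfold `T`, proper and
birational over a complete regular local fourfold base with perfect residue field, regular off the
closed fibre, that NO finite sequence of blow-ups centred over the closed point desingularizes —
a counterexample to (algorithmic) resolution in dimension four.
-/

open CategoryTheory AlgebraicGeometry
open Literature.AlgebraicGeometry.Resolution

set_option linter.dupNamespace false

namespace Summit.ResolutionOfSingularities.ResolutionOfSingularities.Theorems.PatchingRelPerfect.Negative

universe u

/-- **A blowing up whose source is regular leaves the target regular off the centre**: if
`π : X' ⟶ X` is a blow-up along `J` and `X'` is regular, then `𝒪_{X,x}` is regular at every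
`x ∉ Supp J` (over `X ∖ Supp J` the map `π` is an isomorphism, `IsBlowup.isIso_compl`, so the
local rings agree). [folklore] -/
theorem isRegularLocalRing_stalk_of_isBlowup_of_notMem_support {X' X : Scheme.{u}} {π : X' ⟶ X}
    {J : X.IdealSheafData} (hπ : IsBlowup π J) (hreg : Scheme.IsRegular X') {x : X}
    (hx : x ∉ (J.support : Set X)) : IsRegularLocalRing (X.presheaf.stalk x) := by
  let U : X.Opens := ⟨(J.support : Set X)ᶜ, J.support.isClosed.isOpen_compl⟩
  haveI : IsIso (π ∣_ U) := hπ.isIso_compl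
  obtain ⟨z, hz⟩ := (ConcreteCategory.bijective_of_isIso (π ∣_ U).base).2 ⟨x, hx⟩
  have hπz : π.base z.1 = x := by
    have := morphismRestrict_base_coe π U z
    rw [hz] at this
    exact this.symm
  have hzU : π.base z.1 ∈ U := by rw [hπz]; exact hx
  have h := (mem_regularLocus_iff_of_isIso_morphismRestrict π U z.1 hzU).mp
    (by rw [Scheme.mem_regularLocus]; exact hreg z.1)
  rw [Scheme.mem_regularLocus, hπz] at h
  exact h

/-- **The conclusion of the atom forces its off-fibre regularity hypothesis**: for ANY scheme `T`
over a local base `Spec S`, if some blow-up `π : T' ⟶ T` along an ideal sheaf `J` cosupported in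
the closed fibre has regular source, then `T` is already regular off the closed fibre. So the
hypothesis "`T` regular off the closed fibre" of `PunctualCompletePerfect` cannot be dropped or
weakened: any `T` violating it violates the conclusion. [folklore] -/
theorem isRegularLocalRing_stalk_offFibre_of_isBlowup {S : Type u} [CommRing S] [IsLocalRing S]
    {T T' : Scheme.{u}} (f : T ⟶ Spec (.of S)) {J : T.IdealSheafData} {π : T' ⟶ T}
    (hJ : ∀ t : T, t ∈ J.support → f.base t = IsLocalRing.closedPoint S) (hπ : IsBlowup π J)
    (hreg : Scheme.IsRegular T') (t : T) (ht : f.base t ≠ IsLocalRing.closedPoint S) :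
    IsRegularLocalRing (T.presheaf.stalk t) :=
  isRegularLocalRing_stalk_of_isBlowup_of_notMem_support hπ hreg fun h => ht (hJ t h)

/-- **A blow-up with non-empty source is along a non-zero ideal sheaf** (the blowing up of the
zero ideal is the empty scheme: its exceptional "divisor" would be cut out by the regular
element `0`). [folklore] -/
theorem isBlowup_ne_bot_of_nonempty {X' X : Scheme.{u}} {π : X' ⟶ X} {J : X.IdealSheafData}
    (hπ : IsBlowup π J) [Nonempty X'] : J ≠ ⊥ := by
  rintro rfl
  obtain ⟨x'⟩ := ‹Nonempty X'›
  obtain ⟨W, hxW, g, hg, hW⟩ := hπ.isEffectiveCartier x'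
  obtain ⟨y, hy⟩ := nonempty_basicOpen_of_mem_nonZeroDivisors W hxW g hg
  have hyW : y ∈ (W : X'.Opens) := X'.basicOpen_le g hy
  have hsupp : y ∈ (((⊥ : X.IdealSheafData).comap π).support : Set X') := by
    rw [Scheme.IdealSheafData.support_comap]
    change π.base y ∈ ((⊥ : X.IdealSheafData).support : Set X)
    rw [Scheme.IdealSheafData.support_bot]
    trivial
  rw [SetLike.mem_coe, Scheme.IdealSheafData.mem_support_iff_of_mem hyW, hW] at hsupp
  simp only [Scheme.mem_zeroLocus_iff, SetLike.mem_coe] at hsupp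
  exact hsupp g (Ideal.mem_span_singleton_self g) hy

/-- **Towers of fibre-supported blow-ups collapse to one** (Raynaud; Stacks 080B; tree
`IsBlowup.exists_isBlowup_comp_supported`): on a Noetherian scheme `T`, a blow-up along an ideal
cosupported in a closed set `F` followed by a blow-up along an ideal cosupported over `F` is a
single blow-up along a NON-ZERO ideal cosupported in `F`. Hence the single-blow-up format of the
atom `PunctualCompletePerfect` is not more restrictive than "desingularization by any finite
sequence of blow-ups with centres over the closed fibre". [cite: StacksProject, Tag 080B] -/
theorem exists_isBlowup_supported_of_tower {T T₁ T₂ : Scheme.{u}} [IsNoetherian T] (F : Set T)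
    {π₁ : T₁ ⟶ T} {J₁ : T.IdealSheafData} (h₁ : IsBlowup π₁ J₁) (hJ₁ : (J₁.support : Set T) ⊆ F)
    {π₂ : T₂ ⟶ T₁} {J₂ : T₁.IdealSheafData} (h₂ : IsBlowup π₂ J₂)
    (hJ₂ : (J₂.support : Set T₁) ⊆ π₁.base ⁻¹' F) [Nonempty T₂] :
    ∃ J : T.IdealSheafData, J ≠ ⊥ ∧ (J.support : Set T) ⊆ F ∧ IsBlowup (π₂ ≫ π₁) J := by
  obtain ⟨Q, hQ, hsupp⟩ := h₁.exists_isBlowup_comp_supported π₁ J₁ π₂ J₂ F hJ₁ h₂ hJ₂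
  exact ⟨Q, isBlowup_ne_bot_of_nonempty hQ, hsupp, hQ⟩

/-- **The atom's conclusion from a TWO-STEP tower** (corollary, in the atom's own terms): for
`T` proper over a Noetherian local base `Spec S`, two successive blow-ups along ideal sheaves
cosupported over the closed point whose end is a non-empty regular scheme already give ONE
non-zero ideal sheaf cosupported in the closed fibre with regular blowing up. [folklore] -/
theorem atomConclusion_of_two_step {S : Type u} [CommRing S] [IsLocalRing S] [IsNoetherianRing S]
    {T T₁ T₂ : Scheme.{u}} (f : T ⟶ Spec (.of S)) [IsProper f]
    {π₁ : T₁ ⟶ T} {J₁ : T.IdealSheafData} (h₁ : IsBlowup π₁ J₁)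
    (hJ₁ : ∀ t : T, t ∈ J₁.support → f.base t = IsLocalRing.closedPoint S)
    {π₂ : T₂ ⟶ T₁} {J₂ : T₁.IdealSheafData} (h₂ : IsBlowup π₂ J₂)
    (hJ₂ : ∀ t : T₁, t ∈ J₂.support → f.base (π₁.base t) = IsLocalRing.closedPoint S)
    [Nonempty T₂] (hreg : Scheme.IsRegular T₂) :
    ∃ (J : T.IdealSheafData) (T' : Scheme.{u}) (π : T' ⟶ T), J ≠ ⊥ ∧
      (∀ t : T, t ∈ J.support → f.base t = IsLocalRing.closedPoint S) ∧
      IsBlowup π J ∧ Scheme.IsRegular T' := by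
  haveI : IsLocallyNoetherian T := LocallyOfFiniteType.isLocallyNoetherian f
  haveI : CompactSpace T := QuasiCompact.compactSpace_of_compactSpace f
  haveI : IsNoetherian T := {}
  obtain ⟨J, hJ, hsupp, hbl⟩ := exists_isBlowup_supported_of_tower
    (f.base ⁻¹' {IsLocalRing.closedPoint S}) h₁ (fun t ht => hJ₁ t ht) h₂ (fun t ht => hJ₂ t ht)
  exact ⟨J, T₂, π₂ ≫ π₁, hJ, fun t ht => hsupp ht, hbl, hreg⟩

/-- **The atom's conclusion IS a resolution, fibre-free** (so it implies the `HasResolution`-form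
with the "isomorphism off the closed fibre" clause, e.g. the conclusion of `FibreFreePerfClosed`
for the same `T`): a blow-up of an integral locally Noetherian `T` along a non-zero ideal
cosupported in the closed fibre with regular source is proper (`IsBlowup.isProper`, Stacks 02NS
proved in tree), birational (`IsBlowup.isBirational'`, Stacks 02ND proved in tree), and an
isomorphism over the complement of the closed fibre (`IsBlowup.isIso_morphismRestrict`).
[folklore] -/
theorem isResolution_and_isIso_offFibre_of_atomConclusion {S : Type u} [CommRing S] [IsLocalRing S]
    {T T' : Scheme.{u}} [IsIntegral T] [IsLocallyNoetherian T] (f : T ⟶ Spec (.of S))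
    {J : T.IdealSheafData} {π : T' ⟶ T} (hJ0 : J ≠ ⊥)
    (hJ : ∀ t : T, t ∈ J.support → f.base t = IsLocalRing.closedPoint S) (hπ : IsBlowup π J)
    (hreg : Scheme.IsRegular T') :
    IsResolution π ∧ ∃ U : T.Opens, (∀ t : T, t ∈ U ↔ f.base t ≠ IsLocalRing.closedPoint S) ∧
      IsIso (π ∣_ U) := by
  refine ⟨hπ.isResolution' stacks02NS_holds hJ0 hreg, ?_⟩
  have hopen : IsOpen (f.base ⁻¹' {IsLocalRing.closedPoint S})ᶜ :=
    (IsClosed.preimage f.base.hom.continuous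
      (IsLocalRing.isClosed_singleton_closedPoint (R := S))).isOpen_compl
  refine ⟨⟨(f.base ⁻¹' {IsLocalRing.closedPoint S})ᶜ, hopen⟩, fun t => Iff.rfl, ?_⟩
  apply hπ.isIso_morphismRestrict
  rw [Set.disjoint_left]
  intro t ht hts
  exact ht (hJ t hts)

/-- **Hypothesis mutation — off-fibre regularity dropped.** If the atom held WITHOUT its
hypothesis "`T` regular off the closed fibre" (statement `h`, otherwise verbatim
`PunctualCompletePerfect p n` of line `closed-point-slice`), then EVERY integral scheme proper and
birational over such a base would be regular off the closed fibre — the dropped hypothesis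
reappears as a conclusion (`isRegularLocalRing_stalk_offFibre_of_isBlowup`). That conclusion is
false as soon as `n ≥ 3` (e.g. the blowing up of `Spec κ[[x,y,z]]` along `(x², y³)` is integral,
projective and birational over the base and singular at the point `(x, y, y³/x²)` of the chart
`κ[[x,y,z]][y³/x²]`, which lies over the NON-closed point `(x, y)`), so the hypothesis is
load-bearing; this theorem is the formal half of that observation. [folklore] -/
theorem offFibre_regular_of_atom_without_offFibre_hyp (p n : ℕ)
    (h : ∀ (S : Type) [CommRing S] [IsRegularLocalRing S] [CharP S p]
      [IsAdicComplete (IsLocalRing.maximalIdeal S) S]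
      [PerfectField (IsLocalRing.ResidueField S)], ringKrullDim S ≤ n →
      ∀ (T : Scheme.{0}) (f : T ⟶ Spec (.of S)), IsIntegral T → IsProper f → IsBirational f →
        ∃ (J : T.IdealSheafData) (T' : Scheme.{0}) (π : T' ⟶ T), J ≠ ⊥ ∧
          (∀ t : T, t ∈ J.support → f.base t = IsLocalRing.closedPoint S) ∧
          IsBlowup π J ∧ Scheme.IsRegular T') :
    ∀ (S : Type) [CommRing S] [IsRegularLocalRing S] [CharP S p]
      [IsAdicComplete (IsLocalRing.maximalIdeal S) S]
      [PerfectField (IsLocalRing.ResidueField S)], ringKrullDim S ≤ n →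
      ∀ (T : Scheme.{0}) (f : T ⟶ Spec (.of S)), IsIntegral T → IsProper f → IsBirational f →
        ∀ t : T, f.base t ≠ IsLocalRing.closedPoint S →
          IsRegularLocalRing (T.presheaf.stalk t) := by
  intro S _ _ _ _ _ hdim T f hT hf hbir t ht
  obtain ⟨J, T', π, -, hJ, hπ, hreg⟩ := h S hdim T f hT hf hbir
  exact isRegularLocalRing_stalk_offFibre_of_isBlowup f hJ hπ hreg t ht

/-- **The base case `n = 0` of the atom holds outright** (sanity / non-vacuity of the typing, all
`p`): over a zero-dimensional regular local base every point of `Spec S` is the closed point, so a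
birational `f` is an isomorphism over `U = Spec S`, `T ≅ Spec S` is regular, and `J = ⊤` (the
EMPTY centre, `J ≠ ⊥` because `T ≠ ∅`) with the identity blow-up answers. In particular the clause
`J ≠ ⊥` is satisfiable by the unit ideal sheaf and excludes only the empty blow-up.
[folklore] -/
theorem punctual_atom_dim_zero (p : ℕ) :
    ∀ (S : Type) [CommRing S] [IsRegularLocalRing S] [CharP S p]
      [IsAdicComplete (IsLocalRing.maximalIdeal S) S]
      [PerfectField (IsLocalRing.ResidueField S)], ringKrullDim S ≤ (0 : ℕ) →
      ∀ (T : Scheme.{0}) (f : T ⟶ Spec (.of S)), IsIntegral T → IsProper f → IsBirational f →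
        (∀ t : T, f.base t ≠ IsLocalRing.closedPoint S →
          IsRegularLocalRing (T.presheaf.stalk t)) →
        ∃ (J : T.IdealSheafData) (T' : Scheme.{0}) (π : T' ⟶ T), J ≠ ⊥ ∧
          (∀ t : T, t ∈ J.support → f.base t = IsLocalRing.closedPoint S) ∧
          IsBlowup π J ∧ Scheme.IsRegular T' := by
  intro S _ _ _ _ _ hdim T f hT _ hbir _
  -- every point of `Spec S` is the closed point
  haveI : Ring.KrullDimLE 0 S := Ring.krullDimLE_iff.mpr hdim
  have hpt : ∀ x : PrimeSpectrum S, x = IsLocalRing.closedPoint S := fun x =>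
    PrimeSpectrum.ext (IsLocalRing.eq_maximalIdeal x.isPrime.isMaximal')
  obtain ⟨U, hU, -, hiso⟩ := hbir
  haveI := hiso
  have hmem : ∀ t : T, f.base t ∈ U := by
    intro t
    obtain ⟨u, hu⟩ := hU.nonempty
    have h1 : f.base t = IsLocalRing.closedPoint S := hpt (f.base t)
    have h2 : u = IsLocalRing.closedPoint S := hpt u
    rw [h1, ← h2]
    exact hu
  haveI : IsRegularRing S := isRegularRing_of_isRegularLocalRing S
  have hSreg : Scheme.IsRegular (Spec (.of S)) := Scheme.isRegular_Spec (.of S)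
  have hTreg : Scheme.IsRegular T := fun t => by
    have := (mem_regularLocus_iff_of_isIso_morphismRestrict f U t (hmem t)).mpr
      (by rw [Scheme.mem_regularLocus]; exact hSreg _)
    rwa [Scheme.mem_regularLocus] at this
  exact ⟨⊤, T, 𝟙 T, isBlowup_ne_bot_of_nonempty (isBlowup_id_top T), fun t _ => hpt (f.base t),
    isBlowup_id_top T, hTreg⟩

/-- **Hypothesis mutation — `IsBirational f` dropped: the dimension bound becomes void.** If the
atom held WITHOUT birationality of `f` (statement `h`, otherwise verbatim, here at `n = 0`), then —
taking for the base `S` the perfect ground field `κ` itself (a zero-dimensional complete regular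
local ring with perfect residue field) — EVERY integral scheme proper over EVERY perfect field of
characteristic `p`, of ANY dimension, would be desingularized by a single blow-up: resolution of
singularities over perfect fields in all dimensions, in Temkin's one-blow-up format. So
`IsBirational f` is exactly what ties `T` to the dimension of the base; it is load-bearing for the
cut "dimension `≤ 4`" to mean anything. [folklore] -/
theorem resolution_all_dims_of_atom_without_birational (p : ℕ)
    (h : ∀ (S : Type) [CommRing S] [IsRegularLocalRing S] [CharP S p]
      [IsAdicComplete (IsLocalRing.maximalIdeal S) S]
      [PerfectField (IsLocalRing.ResidueField S)], ringKrullDim S ≤ (0 : ℕ) →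
      ∀ (T : Scheme.{0}) (f : T ⟶ Spec (.of S)), IsIntegral T → IsProper f →
        (∀ t : T, f.base t ≠ IsLocalRing.closedPoint S →
          IsRegularLocalRing (T.presheaf.stalk t)) →
        ∃ (J : T.IdealSheafData) (T' : Scheme.{0}) (π : T' ⟶ T), J ≠ ⊥ ∧
          (∀ t : T, t ∈ J.support → f.base t = IsLocalRing.closedPoint S) ∧
          IsBlowup π J ∧ Scheme.IsRegular T')
    (κ : Type) [Field κ] [CharP κ p] [PerfectField κ] (X : Scheme.{0}) (f : X ⟶ Spec (.of κ))
    [IsIntegral X] [IsProper f] :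
    ∃ (X' : Scheme.{0}) (π : X' ⟶ X), IsResolution π ∧
      ∃ J : X.IdealSheafData, J ≠ ⊥ ∧ IsBlowup π J := by
  haveI : IsAdicComplete (IsLocalRing.maximalIdeal κ) κ := by
    rw [IsLocalRing.maximalIdeal_eq_bot]
    infer_instance
  haveI : PerfectField (IsLocalRing.ResidueField κ) :=
    PerfectField.of_ringEquiv (RingEquiv.ofBijective (IsLocalRing.residue κ)
      ⟨(IsLocalRing.residue κ).injective, IsLocalRing.residue_surjective⟩)
  have hdim : ringKrullDim κ ≤ (0 : ℕ) := by
    rw [ringKrullDim_eq_zero_of_field κ]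
    rfl
  have hoff : ∀ t : X, f.base t ≠ IsLocalRing.closedPoint κ →
      IsRegularLocalRing (X.presheaf.stalk t) :=
    fun t ht => absurd (Subsingleton.elim _ _) ht
  obtain ⟨J, X', π, hJ, -, hbl, hreg⟩ := h κ hdim X f ‹_› ‹_› hoff
  haveI : IsLocallyNoetherian X := LocallyOfFiniteType.isLocallyNoetherian f
  exact ⟨X', π, hbl.isResolution' stacks02NS_holds hJ hreg, J, hJ, hbl⟩

end Summit.ResolutionOfSingularities.ResolutionOfSingularities.Theorems.PatchingRelPerfect.Negative
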